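import Literature.Geometry.Kaehler.ComplexTorusAnalyticLimitCycle
import Literature.Geometry.Kaehler.HolomorphicChainAddHolds
import Literature.Geometry.Kaehler.ComplexTorusCompleteLinearSystem
import HarnessLib

/-!
# The class and the degree of the limit cycle

Layer `Literature/Geometry/Kaehler`; lane `lit-hodgefound`, seat p07, programme «BOUNDED CYCLES ON A
COMPLEX TORUS», file 10. For analytic `Z_j ⊆ X = E/Λ` of pure dimension `p = d + 1` with
`[π⁻¹ Z_j] → [T]`, `T ≥ 0`, `ComplexTorusAnalyticLimitCycle.lean` produces an effective `p`-cycle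
`S = Σ_ν m_ν W_ν` of `X` (`W_ν` the irreducible components of the limit set `W = π(|T|)`) of which
`T` is the lift. Here the lift is made explicit and pushed through periods and classes:

* `HolomorphicChain.toCurrent_finset_sum_zsmul` — currents of finite `ℤ`-combinations of chains
  (`[T + T'] = [T] + [T']`, tree `Chirka1989_toCurrent_add_holds`; multiplicities: tree
  `HolomorphicChain.mult_finsetSum_apply`) [Chirka1989, §11.5, §16.1];
* **`ComplexTorus.eq_sum_zsmul_analyticChain_of_descends`** — if `S` descends `T` (the conclusions
  of `exists_effectiveCycle_limit`), then **`T = Σ_ν S.mult W_ν · [π⁻¹ W_ν]`** as holomorphic chains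
  on `E`; `toCurrent_apply_eq_sum_of_descends` — the same for the currents;
* **`ComplexTorus.torusPeriod_eq_sum_of_descends`** — `∫_{T/Λ} η = Σ_ν m_ν ∫_{W_ν} η`
  (periods as current values, `ComplexTorusChainPeriodsWeakLimit.lean`);
  `poincarePairing_poincareDualForm_torusPeriod_eq` — `⟨γ, (∫_{T/Λ})^♭⟩ = ⟨γ, cl(S)⟩`;
* **`ComplexTorus.eventually_analyticCycleClass_eq_chainCycleClass`** — **`[Z_j] = cl(S)` for all
  large `j`**: THE EVENTUAL CLASS OF A CONVERGENT SEQUENCE OF ANALYTIC SUBSETS IS THE CLASS OF AN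
  EFFECTIVE ANALYTIC CYCLE SUPPORTED ON THE LIMIT SET [Fujiki1978, §4 Prop. 4.1; Lange2023, §6.2.1];
  `tendsto_volume_degree` — `vol(Z_j) → deg S = Re ⟨ω^p/p!, cl(S)⟩`;
* **`ComplexTorus.exists_effectiveCycle_class_limit`**, **`exists_subseq_effectiveCycle_of_measure_le`**
  — packaged: for every weakly convergent sequence, resp. for a subsequence of every sequence of
  bounded volume, an effective cycle `S ≥ 0` with `|S| =` the limit set, `[Z_j] = cl(S)` eventually
  and `vol(Z_j) → deg S` — the compactness of the space of effective analytic `p`-cycles of bounded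
  degree on a complex torus, in class form [Fujiki1978, §4 Prop. 4.1; Chirka1989, §16.1 Prop. 1].

Theorems only; no new definitions, no named facts.

## References

* [Chirka1989] E. M. Chirka, *Complex Analytic Sets*, Kluwer 1989, §11.5, §16.1 Prop. 1 and its proof
  (pp. 206–207).
* [Fujiki1978] A. Fujiki, *Closedness of the Douady spaces of compact Kähler spaces*, Publ. RIMS 14
  (1978) 1–52, §4 Prop. 4.1.
* [Lange2023AbelianVarietiesComplex] H. Lange, *Abelian Varieties over the Complex Numbers*, Springer
  2023, §6.2.1.
-/

noncomputable section

open scoped Manifold ENNReal NNReal Topology Distributions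
open MeasureTheory TopologicalSpace Set Function Filter Metric Complex
open Literature.Geometry.GeometricMeasureTheory

namespace Literature.Geometry.Kaehler

-- Nested operator-norm instances on `Covector V m` / `Multivector V m`, as in `Currents.lean`.
set_option maxSynthPendingDepth 2

universe u

/-! ## §1. Finite `ℤ`-combinations of chains -/

namespace HolomorphicChain


variable {V : Type u} [NormedAddCommGroup V] [InnerProductSpace ℂ V] [FiniteDimensional ℂ V]
  [MeasurableSpace V] [BorelSpace V] {Ω : Opens V} {p : ℕ}

/-- **`[Σ k_i T_i] = Σ k_i [T_i]`** for a finite `ℤ`-combination of holomorphic chains.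
[cite: Chirka1989, §16.1, p. 206] -/
theorem toCurrent_finset_sum_zsmul {κ : Type*} (s : Finset κ) (k : κ → ℤ)
    (f : κ → HolomorphicChain 𝓘(ℂ, V) Ω p) :
    (∑ i ∈ s, k i • f i).toCurrent = ∑ i ∈ s, k i • (f i).toCurrent := by
  let Φc : HolomorphicChain 𝓘(ℂ, V) Ω p →+ Current Ω (2 * p) :=
    { toFun := toCurrent
      map_zero' := toCurrent_zero
      map_add' := Chirka1989_toCurrent_add_holds V Ω p }
  have h : (∑ i ∈ s, k i • f i).toCurrent = Φc (∑ i ∈ s, k i • f i) := rfl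
  rw [h, map_sum]
  exact Finset.sum_congr rfl fun i _ ↦ map_zsmul Φc (k i) (f i)

end HolomorphicChain

/-! ## §2. The lift made explicit; periods, class and degree of the limit cycle -/

namespace ComplexTorus

variable {ι : Type*} [Fintype ι] [DecidableEq ι] {E : Type u} [NormedAddCommGroup E]
  [InnerProductSpace ℂ E] [FiniteDimensional ℂ E] [MeasurableSpace E] [BorelSpace E]
  (Φ : (ι → ℝ) ≃L[ℝ] E) {d : ℕ}
  {Z : ℕ → Set (ComplexTorus Φ)} (hZ : ∀ j, HasPureDim 𝓘(ℂ, E) (Z j) (d + 1))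
  {T : HolomorphicChain 𝓘(ℂ, E) (⊤ : Opens E) (d + 1)}
  {S : HolomorphicChain 𝓘(ℂ, E) (ComplexTorus Φ) (d + 1)}

omit [DecidableEq ι] [MeasurableSpace E] [BorelSpace E] in
/-- **`T = Σ_ν S.mult W_ν · [π⁻¹ W_ν]`** as holomorphic chains on `E`, when `S` descends `T` (every
component of `T` is an irreducible component of exactly one `π⁻¹ W_ν`, `S.mult W_ν ≠ 0`, with that
multiplicity, and conversely). [cite: Chirka1989, §16.1 Prop. 1 (proof), p. 207] -/
theorem eq_sum_zsmul_analyticChain_of_descends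
    (hS₁ : ∀ C : Set (⊤ : Opens E), T.mult C ≠ 0 → ∃ W', S.mult W' ≠ 0 ∧
      IsIrreducibleComponent 𝓘(ℂ, E) (liftSet Φ W') C ∧ T.mult C = S.mult W' ∧
      ∀ W'', S.mult W'' ≠ 0 → IsIrreducibleComponent 𝓘(ℂ, E) (liftSet Φ W'') C → W'' = W')
    (hS₂ : ∀ C : Set (⊤ : Opens E), ∀ W', S.mult W' ≠ 0 →
      IsIrreducibleComponent 𝓘(ℂ, E) (liftSet Φ W') C → T.mult C ≠ 0) :
    T = ∑ W' ∈ S.finite_components_of_compactSpace.toFinset.attach,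
      S.mult W'.1 • analyticChain Φ (S.hasPureDim_of_mult_ne_zero
        (S.finite_components_of_compactSpace.mem_toFinset.1 W'.2)) := by
  classical
  set F := S.finite_components_of_compactSpace.toFinset with hF
  have hmemF : ∀ {W'}, W' ∈ F ↔ S.mult W' ≠ 0 := fun {W'} ↦ by
    rw [hF, Set.Finite.mem_toFinset]; rfl
  ext C
  rw [HolomorphicChain.mult_finsetSum_apply]
  simp only [HolomorphicChain.mult_zsmul, Pi.smul_apply, smul_eq_mul, analyticChain,
    HolomorphicChain.mult_ofSet, mul_ite, mul_one, mul_zero]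
  by_cases hC : T.mult C = 0
  · rw [hC, eq_comm]
    refine Finset.sum_eq_zero fun W' _ ↦ ?_
    rw [ite_eq_right_iff]
    intro hCW'
    exact absurd hC (hS₂ C W'.1 (hmemF.1 W'.2) hCW')
  · obtain ⟨W₀, hW₀, hCW₀, hTC, huniq⟩ := hS₁ C hC
    rw [Finset.sum_eq_single ⟨W₀, hmemF.2 hW₀⟩, if_pos hCW₀, hTC]
    · rintro W' - hne
      rw [ite_eq_right_iff]
      intro hCW'
      exact absurd (Subtype.ext (huniq W'.1 (hmemF.1 W'.2) hCW')) hne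
    · intro h
      exact absurd (Finset.mem_attach _ _) h

omit [DecidableEq ι] in
/-- **`[T](φ) = Σ_ν S.mult W_ν · [π⁻¹ W_ν](φ)`** on every test form. [cite: Chirka1989, §16.1, p. 206] -/
theorem toCurrent_apply_eq_sum_of_descends
    (hS₁ : ∀ C : Set (⊤ : Opens E), T.mult C ≠ 0 → ∃ W', S.mult W' ≠ 0 ∧
      IsIrreducibleComponent 𝓘(ℂ, E) (liftSet Φ W') C ∧ T.mult C = S.mult W' ∧
      ∀ W'', S.mult W'' ≠ 0 → IsIrreducibleComponent 𝓘(ℂ, E) (liftSet Φ W'') C → W'' = W')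
    (hS₂ : ∀ C : Set (⊤ : Opens E), ∀ W', S.mult W' ≠ 0 →
      IsIrreducibleComponent 𝓘(ℂ, E) (liftSet Φ W') C → T.mult C ≠ 0)
    (φ : TestForm (⊤ : Opens E) (2 * (d + 1))) :
    T.toCurrent φ = ∑ W' ∈ S.finite_components_of_compactSpace.toFinset.attach,
      S.mult W'.1 • (analyticChain Φ (S.hasPureDim_of_mult_ne_zero
        (S.finite_components_of_compactSpace.mem_toFinset.1 W'.2))).toCurrent φ := by
  conv_lhs => rw [eq_sum_zsmul_analyticChain_of_descends Φ hS₁ hS₂]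
  rw [HolomorphicChain.toCurrent_finset_sum_zsmul, FunLike.coe_sum, Finset.sum_apply]
  simp only [FunLike.coe_smul, Pi.smul_apply]

/-- **`∫_{T/Λ} η = Σ_ν S.mult W_ν · ∫_{W_ν} η`** for the limit chain: periods of `Λ`-periodic chains
are values of the currents on `w η` (`ComplexTorusChainPeriodsWeakLimit.lean`).
[cite: Fujiki1978, §2 Prop. 2.10, §4 Prop. 4.1; Chirka1989, §16.1 Prop. 1, p. 207] -/
theorem torusPeriod_eq_sum_of_descends (hT : ∀ Y, 0 ≤ T.mult Y)
    (hconv : ∀ ψ, Tendsto (fun j ↦ (analyticChain Φ (hZ j)).toCurrent ψ) atTop (𝓝 (T.toCurrent ψ)))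
    (hS₁ : ∀ C : Set (⊤ : Opens E), T.mult C ≠ 0 → ∃ W', S.mult W' ≠ 0 ∧
      IsIrreducibleComponent 𝓘(ℂ, E) (liftSet Φ W') C ∧ T.mult C = S.mult W' ∧
      ∀ W'', S.mult W'' ≠ 0 → IsIrreducibleComponent 𝓘(ℂ, E) (liftSet Φ W'') C → W'' = W')
    (hS₂ : ∀ C : Set (⊤ : Opens E), ∀ W', S.mult W' ≠ 0 →
      IsIrreducibleComponent 𝓘(ℂ, E) (liftSet Φ W') C → T.mult C ≠ 0)
    (η : E [⋀^Fin (2 * (d + 1))]→L[ℝ] ℂ) :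
    T.torusPeriod Φ η = ∑ W' ∈ S.finite_components_of_compactSpace.toFinset.attach,
      (S.mult W'.1 : ℂ) * analyticCyclePeriod Φ (S.hasPureDim_of_mult_ne_zero
        (S.finite_components_of_compactSpace.mem_toFinset.1 W'.2)) η := by
  obtain ⟨χ, hχ⟩ := exists_testFunction_eq_weight Φ
  rw [T.torusPeriod_eq_toCurrent Φ (latticeVec_add_mem_carrier_limit_iff Φ hZ hconv)
    (fun m _ hx ↦ density_limit_latticeVec_add Φ hZ hT hconv m hx) hχ η,
    toCurrent_apply_eq_sum_of_descends Φ hS₁ hS₂, toCurrent_apply_eq_sum_of_descends Φ hS₁ hS₂]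
  simp_rw [analyticCyclePeriod_eq_toCurrent Φ _ hχ η]
  simp only [zsmul_eq_mul, ofReal_sum, ofReal_mul, ofReal_intCast, Finset.mul_sum, mul_add,
    Finset.sum_add_distrib]
  congr 1
  exact Finset.sum_congr rfl fun _ _ ↦ by ring

variable {n k : ℕ} (e : Fin n ≃ ι)

/-- `⟨γ, (∫_{T/Λ})^♭⟩ = ⟨γ, cl(S)⟩` for every invariant form `γ`. [cite: Lange2023AbelianVarietiesComplex, §6.2.1; Fujiki1978, §4 Prop. 4.1] -/
theorem poincarePairing_poincareDualForm_torusPeriod_eq (h : 2 * (d + 1) + k = n) (hT : ∀ Y, 0 ≤ T.mult Y)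
    (hconv : ∀ ψ, Tendsto (fun j ↦ (analyticChain Φ (hZ j)).toCurrent ψ) atTop (𝓝 (T.toCurrent ψ)))
    (hS₁ : ∀ C : Set (⊤ : Opens E), T.mult C ≠ 0 → ∃ W', S.mult W' ≠ 0 ∧
      IsIrreducibleComponent 𝓘(ℂ, E) (liftSet Φ W') C ∧ T.mult C = S.mult W' ∧
      ∀ W'', S.mult W'' ≠ 0 → IsIrreducibleComponent 𝓘(ℂ, E) (liftSet Φ W'') C → W'' = W')
    (hS₂ : ∀ C : Set (⊤ : Opens E), ∀ W', S.mult W' ≠ 0 →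
      IsIrreducibleComponent 𝓘(ℂ, E) (liftSet Φ W') C → T.mult C ≠ 0)
    (γ : E [⋀^Fin (2 * (d + 1))]→L[ℝ] ℂ) :
    poincarePairing Φ e h γ (poincareDualForm Φ e h (T.torusPeriod Φ)) =
      poincarePairing Φ e h γ (chainCycleClass Φ e h S) := by
  rw [poincarePairing_poincareDualForm, torusPeriod_eq_sum_of_descends Φ hZ hT hconv hS₁ hS₂,
    poincarePairing_chainCycleClass,
    ← Finset.sum_attach S.finite_components_of_compactSpace.toFinset
      (fun W' ↦ (S.mult W' : ℂ) * poincarePairing Φ e h γ (setCycleClass Φ e h W'))]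
  refine Finset.sum_congr rfl fun W' _ ↦ ?_
  rw [setCycleClass_of_hasPureDim Φ e h (S.hasPureDim_of_mult_ne_zero
    (S.finite_components_of_compactSpace.mem_toFinset.1 W'.2)), poincarePairing_analyticCycleClass]

/-- **`[Z_j] = cl(S)` for all large `j`**: the eventual class of the convergent sequence is the class
of the effective analytic cycle `S` of `X` descended from the limit chain.
[cite: Fujiki1978, §4 Prop. 4.1; Lange2023AbelianVarietiesComplex, §6.2.1] -/
theorem eventually_analyticCycleClass_eq_chainCycleClass (h : 2 * (d + 1) + k = n)
    (hT : ∀ Y, 0 ≤ T.mult Y)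
    (hconv : ∀ ψ, Tendsto (fun j ↦ (analyticChain Φ (hZ j)).toCurrent ψ) atTop (𝓝 (T.toCurrent ψ)))
    (hS₁ : ∀ C : Set (⊤ : Opens E), T.mult C ≠ 0 → ∃ W', S.mult W' ≠ 0 ∧
      IsIrreducibleComponent 𝓘(ℂ, E) (liftSet Φ W') C ∧ T.mult C = S.mult W' ∧
      ∀ W'', S.mult W'' ≠ 0 → IsIrreducibleComponent 𝓘(ℂ, E) (liftSet Φ W'') C → W'' = W')
    (hS₂ : ∀ C : Set (⊤ : Opens E), ∀ W', S.mult W' ≠ 0 →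
      IsIrreducibleComponent 𝓘(ℂ, E) (liftSet Φ W') C → T.mult C ≠ 0) :
    ∀ᶠ j in atTop, analyticCycleClass Φ e h (hZ j) = chainCycleClass Φ e h S := by
  have hPD : poincareDualForm Φ e h (T.torusPeriod Φ) = chainCycleClass Φ e h S :=
    eq_of_forall_poincarePairing_latMonomial_eq Φ e h fun w ↦
      poincarePairing_poincareDualForm_torusPeriod_eq Φ hZ e h hT hconv hS₁ hS₂ _
  filter_upwards [eventually_analyticCycleClass_eq_limit Φ hZ e h hT hconv] with j hj
  rw [hj, hPD]

/-- **`vol(Z_j) → deg S = Re ⟨ω^p/p!, cl(S)⟩`.** [cite: Fujiki1978, §4 Prop. 4.1] -/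
theorem tendsto_volume_degree (h : 2 * (d + 1) + k = n) (hT : ∀ Y, 0 ≤ T.mult Y)
    (hconv : ∀ ψ, Tendsto (fun j ↦ (analyticChain Φ (hZ j)).toCurrent ψ) atTop (𝓝 (T.toCurrent ψ)))
    (hS₁ : ∀ C : Set (⊤ : Opens E), T.mult C ≠ 0 → ∃ W', S.mult W' ≠ 0 ∧
      IsIrreducibleComponent 𝓘(ℂ, E) (liftSet Φ W') C ∧ T.mult C = S.mult W' ∧
      ∀ W'', S.mult W'' ≠ 0 → IsIrreducibleComponent 𝓘(ℂ, E) (liftSet Φ W'') C → W'' = W')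
    (hS₂ : ∀ C : Set (⊤ : Opens E), ∀ W', S.mult W' ≠ 0 →
      IsIrreducibleComponent 𝓘(ℂ, E) (liftSet Φ W') C → T.mult C ≠ 0) :
    Tendsto (fun j ↦ (μHE[2 * (d + 1)] : Measure E).real
        (periodBox Φ 0 ∩ (analyticChain Φ (hZ j)).carrier)) atTop
      (𝓝 (poincarePairing Φ e h (ofRealCLM.compContinuousAlternatingMap (kaehlerPow (d + 1)))
        (chainCycleClass Φ e h S)).re) := by
  rw [← poincarePairing_poincareDualForm_torusPeriod_eq Φ hZ e h hT hconv hS₁ hS₂,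
    poincarePairing_poincareDualForm]
  exact tendsto_volume_limit Φ hZ hT hconv

/-- **THE CLASS OF THE LIMIT.** If `[π⁻¹ Z_j] → [T]`, `T ≥ 0`, then there is an EFFECTIVE analytic
`p`-cycle `S ≥ 0` of `X`, supported exactly on the limit set `W = π(|T|)`, with `[Z_j] = cl(S)` for
all large `j` and `vol(Z_j) → deg S`. [cite: Fujiki1978, §4 Prop. 4.1; Chirka1989, §16.1 Prop. 1, p. 207] -/
theorem exists_effectiveCycle_class_limit (h : 2 * (d + 1) + k = n) (hT : ∀ Y, 0 ≤ T.mult Y)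
    (hconv : ∀ ψ, Tendsto (fun j ↦ (analyticChain Φ (hZ j)).toCurrent ψ) atTop (𝓝 (T.toCurrent ψ))) :
    ∃ S : HolomorphicChain 𝓘(ℂ, E) (ComplexTorus Φ) (d + 1), (∀ W', 0 ≤ S.mult W') ∧
      S.support = cover Φ '' (((↑) : (⊤ : Opens E) → E) '' T.support) ∧
      (∀ᶠ j in atTop, analyticCycleClass Φ e h (hZ j) = chainCycleClass Φ e h S) ∧
      Tendsto (fun j ↦ (μHE[2 * (d + 1)] : Measure E).real
          (periodBox Φ 0 ∩ (analyticChain Φ (hZ j)).carrier)) atTop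
        (𝓝 (poincarePairing Φ e h (ofRealCLM.compContinuousAlternatingMap (kaehlerPow (d + 1)))
          (chainCycleClass Φ e h S)).re) := by
  obtain ⟨S, hS0, -, hsupp, hS₁, hS₂⟩ := exists_effectiveCycle_limit Φ hZ hT hconv
  exact ⟨S, hS0, hsupp, eventually_analyticCycleClass_eq_chainCycleClass Φ hZ e h hT hconv hS₁ hS₂,
    tendsto_volume_degree Φ hZ e h hT hconv hS₁ hS₂⟩

/-- **COMPACTNESS OF EFFECTIVE ANALYTIC CYCLES OF BOUNDED VOLUME ON A COMPLEX TORUS, CLASS FORM.**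
Analytic subsets `Z_j ⊆ X` of pure dimension `p = d + 1` with `𝓗^{2p}(π⁻¹Z_j ∩ Φ([0,1)^ι)) ≤ M < ∞`
have a subsequence `κ` and an EFFECTIVE analytic `p`-cycle `S ≥ 0` of `X` (supported on the limit set)
with `[Z_{κ j}] = cl(S)` for all large `j` and `vol(Z_{κ j}) → deg S`.
[cite: Fujiki1978, §4 Prop. 4.1; Chirka1989, §15.5 Cor., §16.1 Prop. 1] -/
theorem exists_subseq_effectiveCycle_of_measure_le (h : 2 * (d + 1) + k = n) {M : ℝ≥0∞} (hM : M < ⊤)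
    (hvol : ∀ j, (μHE[2 * (d + 1)] : Measure E) (cover Φ ⁻¹' Z j ∩ periodBox Φ 0) ≤ M) :
    ∃ (κ : ℕ → ℕ) (S : HolomorphicChain 𝓘(ℂ, E) (ComplexTorus Φ) (d + 1)), StrictMono κ ∧
      (∀ W', 0 ≤ S.mult W') ∧ HasPureDim 𝓘(ℂ, E) S.support (d + 1) ∧
      (∀ z, z ∈ S.support ↔ ∀ N : ℕ, z ∈ closure (⋃ j ≥ N, Z (κ j))) ∧
      (∀ᶠ j in atTop, analyticCycleClass Φ e h (hZ (κ j)) = chainCycleClass Φ e h S) ∧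
      Tendsto (fun j ↦ (μHE[2 * (d + 1)] : Measure E).real
          (periodBox Φ 0 ∩ (analyticChain Φ (hZ (κ j))).carrier)) atTop
        (𝓝 (poincarePairing Φ e h (ofRealCLM.compContinuousAlternatingMap (kaehlerPow (d + 1)))
          (chainCycleClass Φ e h S)).re) := by
  obtain ⟨T, κ, hκ, hconv, hT⟩ := exists_subseq_tendsto_analyticChain Φ hZ hM hvol
  have hZ' : ∀ j, HasPureDim 𝓘(ℂ, E) (Z (κ j)) (d + 1) := fun j ↦ hZ (κ j)
  obtain ⟨S, hS0, hsupp, hcl, hvolS⟩ := exists_effectiveCycle_class_limit Φ hZ' e h hT hconv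
  refine ⟨κ, S, hκ, hS0, ?_, fun z ↦ ?_, hcl, hvolS⟩
  · rw [hsupp]; exact hasPureDim_image_cover_support_limit Φ hZ' hT hconv
  · rw [hsupp]; exact mem_image_cover_support_iff_of_tendsto Φ hZ' hconv z

end ComplexTorus

end Literature.Geometry.Kaehler

end
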